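import Literature.MathematicalPhysics.QuantumFieldTheory.Balaban1983to89.B5Eq129FreeResolventDecayedLetterSite
import Literature.MathematicalPhysics.QuantumFieldTheory.Balaban1983to89.B5Eq129FreeResolventZoneSumLetters

/-!
# `Balaban1983to89.B5Eq129FreeResolventDecayedLetterSiteDiag` — T. Bałaban, *Propagators and renormalization transformations for lattice gauge theories. I*,
# Commun. Math. Phys. **95** (1984) 17–40 [Balaban1984PropagatorsI] (1.29) p. 23, Prop. 1.1 p. 33, with *Propagators for lattice gauge theories in a background
# field*, Commun. Math. Phys. **99** (1985) 389–434 [Balaban1985BackgroundPropagators] (3.11) p. 392, Thm 3.1 (3.42) p. 397: **(D-FS) ON THE CHAIN's LATTICE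
# `TSite d P` AT THE DIAGONAL — THE LEVEL-FREE CONSTANT: for `k ≥ d`, `t ≤ P_ν`, `c₀·t^d = c₁`, unit mass, the decayed free letter reads
# `φ_k(x₀) ≤ √(3^d∕c₁ · λ^{−k} · W(x₀)) · √(Σ_y c₀φ₀(y)²∕W(y))` for ANY supersolution weight, and the (D-A) binder `hDFS` with the `cosh` weight carries
# `C₃ = √(3^d∕c₁ · λ^{−k})` — free of the side `t = η⁻¹` (hence of the HEIGHT on `towerP L m (n+1)`, `t = L^{n+1}`) and of the volume** — the junction of the
# NE9 OWNER t4-ne9-p1 g90's `B5Eq129FreeResolventDecayedLetterSite.chain_apply_le_weighted_site ∕ hDFS_cosh_site` (ḡ_k displayed) with this lineage's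
# `B5Eq129FreeResolventZoneSumLetters.entry_const_diag_le` (`ḡ_k∕c₀ ≤ 3^d∕c₁`), which the OWNER's `STOREY-D-ASSEMBLY.md` §3 names for the TOWER twin of the
# (D-A) assembly («LEVEL-FREENESS: use leaf-02's `entry_const_diag_le` … instead of INTENT-3's crude `ḡ_k ≤ 1` (which leaves `1∕c₀ = L^{(n+1)d}`)»)

statement-level skeleton of published theorems with citation tags; proofs where landed; nothing here is a claim about the Yang–Mills mass gap

CITATION HEADER (lean-in-tree rule).  Audit cell `pub-balaban`, sub-cell `t4`, BINDER row NE9; filed by NE9 formalisation-swarm LEAF PROVER 02 (lineage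
`b2b-balaban-t4-ne9-formalise-leaf-02`, gen 72; the (D-FS) ∕ `…ZoneSumLetters` author).  Sources as quoted verbatim in the two imported files
([Balaban1985BackgroundPropagators] p. 397 Thm 3.1 (3.42) *«… ≤ B₀e^{−δ₀d(y,y′)} … B₀ dependent on d and L only»*, (3.11) p. 392; [Balaban1984PropagatorsI]
(1.29) p. 23, Prop. 1.1 p. 33).  MECHANISM ([folklore], two lines each): the displayed spectral constant `ḡ_k(t,1)∕c₀` of the OWNER's letters is bounded by
`3^d∕c₁` (`entry_const_diag_le`: each zone-sum factor `P_ν⁻¹ + π∕(4t) ≤ 3∕t`, and `c₀t^d = c₁` absorbs `t^{−d}`), monotonicity of `√`.  NOTHING printed is used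
as a hypothesis; `[cite: …]` tags are TEXT LOCATIONS (ABSOLUTE RULE).

WHAT IS PROVED (sorry-free; 0 `def`).  `P : Fin d → ℕ` positive; `k ≥ d`; `0 < t ≤ P_ν`; `0 < c₀`, `c₀·t^d = c₁`; chains in the graph form of
`B5Eq129FreeResolventDecayedLetterSite` (`Sum.elim unshift shift`, unit mass).
* **`chain_apply_le_weighted_site_diag`** — any weight `W > 0` with `λW ≤ (L₀+1)W` (`0 < λ`): `φ_k(x₀) ≤ √(3^d∕c₁·λ^{−k}·W(x₀))·√(Σ_y c₀φ₀(y)²∕W(y))`.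
* **`hDFS_cosh_site_diag`** — at `t = η⁻¹`, the `cosh` weight centred at `x₀`, `0 < λ = 1 − 2d·η⁻²(cosh a − 1)`: the binder `hDFS` of
  `B9Eq342GreenPrimeSupBoundDecay.norm_GpOfU_apply_le_decay ∕ _rowSum` (and of its tower twin at `P := towerP L m (n+1)`, `η⁻¹ = L^{n+1}`) with
  `C₃ = √(3^d∕c₁·λ^{−k})` — LEVEL-FREE, VOLUME-FREE.
HONEST SCOPE.  Two-line compositions BY NAME; FREE flat stencil; nothing of [B9] Thm 3.1 ∕ [B5] Prop. 1.1 asserted or valued; «NE9 ⇐ the named binders»; NE9 NOT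
PRINTED ∕ NOT PROVED; row WALLED ON A MODEL (O-NE9-1; #5 UNRULED); NOT summit progress (cell pub-balaban: spine PROVED 0∕9; rung (B)+1 finite T⁴ — NOT infinite
volume, NOT mass gap, NOT BetaPertH, NOT Clay).  HONEST DEPENDENCY (cell line): continuum YM on T⁴ ⇐ BetaPertH ∧ nine spine estimates (0/9 proved); BetaPertH ⇐
(D1) ∧ (D4) ∧ CAP+tail; G-an2-4 gates asym, D1 and NE2/3/4.  NEW file importing `B5Eq129FreeResolventDecayedLetterSite` + `B5Eq129FreeResolventZoneSumLetters`;
nothing modified.  Net new unproved facts: 0.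
-/

noncomputable section

open scoped BigOperators

namespace Literature.MathematicalPhysics.QuantumFieldTheory.Balaban1983to89.B5Eq129FreeResolventDecayedLetterSiteDiag

open B4Sect5Torus (TSite)
open B9SectCLatticeCarrier (shift unshift)
open B5Prop11Plancherel (Tor chi unitVec)
open B4TorusKernel.MultiPeriod (circAbs)
open B5Eq129FreeResolventDecayedLetterSite (chain_apply_le_weighted_site hDFS_cosh_site)
open B5Eq129FreeResolventZoneSumLetters (entry_const_diag_le)

variable {d : ℕ} (P : Fin d → ℕ) [hP : ∀ i, NeZero (P i)]

/-- **(D-FS) ON `TSite d P` AT THE DIAGONAL, ANY SUPERSOLUTION WEIGHT** (`k ≥ d`, `0 < t ≤ P_ν`, `c₀·t^d = c₁`, unit mass, `0 < λ`, `W > 0`,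
`λW ≤ (L₀+1)W` in the graph form): `φ_k(x₀) ≤ √(3^d∕c₁·λ^{−k}·W(x₀))·√(Σ_y c₀φ₀(y)²∕W(y))` — the OWNER's `chain_apply_le_weighted_site` with its
displayed `ḡ_k∕c₀` bounded by `3^d∕c₁` (`entry_const_diag_le`): LEVEL-FREE, VOLUME-FREE.
[cite: Balaban1985BackgroundPropagators, Thm 3.1 (3.42) p.397, (3.11) p.392; Balaban1984PropagatorsI, (1.29) p.23, Prop. 1.1 p.33] -/
theorem chain_apply_le_weighted_site_diag {k : ℕ} (hk : d ≤ k) {t c₀ c₁ lam : ℝ} (ht : 0 < t) (hc₀ : 0 < c₀) (hc₁ : c₀ * t ^ d = c₁)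
    (hvol : ∀ ν, t ≤ (P ν : ℝ)) (hlam : 0 < lam) {W : TSite d P → ℝ} (hW : ∀ y, 0 < W y)
    (hsup : ∀ y, lam * W y ≤ ∑ j : Fin d ⊕ Fin d, t ^ 2 * (W y - W (Sum.elim (fun ν => unshift ν y) (fun ν => shift ν y) j)) + 1 * W y)
    {φ : ℕ → TSite d P → ℝ}
    (hφ : ∀ j < k, ∀ x, ∑ i : Fin d ⊕ Fin d, t ^ 2 * (φ (j + 1) x - φ (j + 1) (Sum.elim (fun ν => unshift ν x) (fun ν => shift ν x) i)) +
      1 * φ (j + 1) x = φ j x) (x₀ : TSite d P) :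
    φ k x₀ ≤ Real.sqrt (3 ^ d / c₁ * (lam ^ k)⁻¹ * W x₀) * Real.sqrt (∑ y, c₀ * φ 0 y ^ 2 / W y) := by
  refine (chain_apply_le_weighted_site P t one_pos hc₀ hlam hW hsup hφ x₀).trans
    (mul_le_mul_of_nonneg_right (Real.sqrt_le_sqrt ?_) (Real.sqrt_nonneg _))
  have hg := entry_const_diag_le P hk ht hc₀ hc₁ hvol
  have hl : 0 ≤ (lam ^ k)⁻¹ * W x₀ := mul_nonneg (inv_nonneg.2 (pow_nonneg hlam.le k)) (hW x₀).le
  rw [show (∑ p : Tor P, (((∑ ν, t ^ 2 * (2 - 2 * (chi P p (unitVec P ν)).re)) + 1) ^ k)⁻¹) / Fintype.card (Tor P) * (lam ^ k)⁻¹ * W x₀ / c₀ =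
      (∑ p : Tor P, (((∑ ν, t ^ 2 * (2 - 2 * (chi P p (unitVec P ν)).re)) + 1) ^ k)⁻¹) / Fintype.card (Tor P) / c₀ * ((lam ^ k)⁻¹ * W x₀) by ring,
    show 3 ^ d / c₁ * (lam ^ k)⁻¹ * W x₀ = 3 ^ d / c₁ * ((lam ^ k)⁻¹ * W x₀) by ring]
  exact mul_le_mul_of_nonneg_right hg hl

/-- **THE BINDER `hDFS` OF THE (D-A) ASSEMBLY WITH THE LEVEL-FREE CONSTANT** (`k ≥ d`, `t = η⁻¹ ≤ P_ν`, `c₀·η^{−d} = c₁`, the `cosh` weight centred at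
`x₀`, `0 < λ = 1 − 2d·η⁻²(cosh a − 1)`): for every `k`-chain `ψ` in the graph form, `ψ_k(x₀) ≤ √(3^d∕c₁·λ^{−k})·√(Σ_y c₀ψ₀(y)²∕W_{x₀}(y))` — the OWNER's
`hDFS_cosh_site` with `ḡ_k∕c₀ ≤ 3^d∕c₁`; at `P := towerP L m (n+1)`, `η⁻¹ = L^{n+1}` the constant is FREE OF THE HEIGHT (the form the tower twin of
`B9Eq342GreenPrimeSupBoundDecayCosh` consumes). [cite: Balaban1985BackgroundPropagators, Thm 3.1 (3.42) p.397, (3.23) p.394, (3.11) p.392; Balaban1984PropagatorsI, Prop. 1.1 p.33] -/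
theorem hDFS_cosh_site_diag {k : ℕ} (hk : d ≤ k) (a η : ℝ) {c₀ c₁ : ℝ} (ht : 0 < η⁻¹) (hc₀ : 0 < c₀) (hc₁ : c₀ * (η⁻¹) ^ d = c₁)
    (hvol : ∀ ν, η⁻¹ ≤ (P ν : ℝ)) (hlam : 0 < 1 - 2 * d * (η⁻¹) ^ 2 * (Real.cosh a - 1)) (x₀ : TSite d P) :
    ∀ ψ : ℕ → TSite d P → ℝ, (∀ j < k, ∀ x, ∑ i : Fin d ⊕ Fin d,
        (η⁻¹) ^ 2 * (ψ (j + 1) x - ψ (j + 1) (Sum.elim (fun μ => unshift μ x) (fun μ => shift μ x) i)) + 1 * ψ (j + 1) x = ψ j x) →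
      ψ k x₀ ≤ Real.sqrt (3 ^ d / c₁ * ((1 - 2 * d * (η⁻¹) ^ 2 * (Real.cosh a - 1)) ^ k)⁻¹) *
        Real.sqrt (∑ y, c₀ * ψ 0 y ^ 2 /
          ∏ μ, Real.cosh (a * (circAbs (P μ) (((((x₀ μ : ℕ) : ZMod (P μ)) - ((y μ : ℕ) : ZMod (P μ))).val : ℕ) : ℤ) : ℝ))) := by
  intro ψ hψ
  refine (hDFS_cosh_site P a η hc₀ hlam k x₀ ψ hψ).trans (mul_le_mul_of_nonneg_right (Real.sqrt_le_sqrt ?_) (Real.sqrt_nonneg _))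
  have hg := entry_const_diag_le P hk ht hc₀ hc₁ hvol
  have hl : 0 ≤ ((1 - 2 * d * (η⁻¹) ^ 2 * (Real.cosh a - 1)) ^ k)⁻¹ := inv_nonneg.2 (pow_nonneg hlam.le k)
  rw [mul_div_right_comm]
  exact mul_le_mul_of_nonneg_right hg hl

end Literature.MathematicalPhysics.QuantumFieldTheory.Balaban1983to89.B5Eq129FreeResolventDecayedLetterSiteDiag

end
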